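import Literature.NumberTheory.LFunctions.ChebyshevHalfLineBiasVariants
import Literature.NumberTheory.LFunctions.ExplicitFormulaPsiChar
import HarnessLib

/-!
# GRH-CONDITIONAL / GRH-EQUIVALENT criteria for Dirichlet `L`-functions (Suzuki 2025, Thms 6, 8, 9) — «nothing here bears on the truth of RH»
# The half-line Chebyshev bias for a general Dirichlet character and for the progression `n ≡ 1 (mod q)`

TRIAGE-TYPING, AS PRINTED, statements only (named facts `def … : Prop`, D-0014), status note, NO endorsement
(RH literature-typing tranche 1 part 2, director-rh 2026-08-26; this file completes the typing of the source begun in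
`ChebyshevHalfLineBiasVariants.lean`, whose module docstring listed Thms 6, 8, 9 as `TODO(general form)`). Source, read at
the page (held text `paper:arxiv-2411.07436`, §1.3 = chunk p0005, §4 = p0011–p0013, §5.1 = p0014–p0015; PUBLISHED, refereed):

> M. Suzuki, *On variants of Chebyshev's conjecture*, Ramanujan J. **68** (2025), no. 4, art. 95,
> doi:10.1007/s11139-025-01238-9 = arXiv:2411.07436 [bib: `Suzuki2025Chebyshev`].

* **Thm 8** (§4.1; `χ` non-principal mod `q`): first half (constant sign of `Σ_{n ≤ x} Λ(n) Re χ(n) n^{-1/2} log(x/n)` and no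
  real zeros right of `β` ⟹ no zeros in `Re s > β`) → `Suzuki2025Chebyshev_thm8_sign`; second half (`L(½, χ) ≠ 0`:
  Riesz limit (4.2) ⟺ GRH, its primitive-character supplement (4.2) ⟹ eventual constant sign, and the order-`m` version
  (4.2') ⟺ GRH) → `Suzuki2025Chebyshev_thm8_limits` (one fact, three clauses).
  Thm 3 of the paper is Thm 8 at `χ = χ₄` (`Suzuki2025Chebyshev_thm3`, `ChebyshevHalfLineBiasVariants.lean`).
* **Thm 9** (§4.2; `χ` real, non-principal): first half (eventual `Σ_{p ≤ x} χ(p) log p √(x/p) log(x/p) ≤ 0` and no real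
  zeros right of `β` ⟹ no zeros in `Re s > β`) → `Suzuki2025Chebyshev_thm9_sign`; second half (GRH and `L(½, χ) ≠ 0` ⟹ the
  asymptotic (4.8)) → `Suzuki2025Chebyshev_thm9_asymp`. Thm 4 is Thm 9 at `χ = χ₄` (`Suzuki2025Chebyshev_thm4`).
* **Thm 6** (§1.3; all characters mod `q`, the progression `n ≡ 1 (mod q)`): claim (i) (sign criteria ⟹ zero-free region)
  → `Suzuki2025Chebyshev_thm6_i`; claims (ii)–(v) (the four Riesz-limit equivalences) → `Suzuki2025Chebyshev_thm6_limits`.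
Granularity: one named fact per printed «half» (sign criterion / limit criteria), six facts for the three theorems.

Encodings, for the referee (tree vocabulary only; no new definition is introduced).
(1) `L(s, χ)` = Mathlib's `DirichletCharacter.LFunction χ`; «GRH for `L(s, χ)`» («for an imprimitive `χ` we define the GRH
to hold for `L(s,χ)` as the GRH to hold for `L(s,χ*)`», §1.3) = the tree's open-strip `DirichletCharacter.RiemannHypothesis χ`
(`GeneralizedRH.lean`), which is equivalent to that of the inducing primitive character
(`riemannHypothesis_iff_primitiveCharacter_holds`: the Euler factors `1 − χ*(p)p^{-s}` vanish only on `Re s = 0`).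
(2) «`L(σ, χ) ≠ 0` for `σ > β`» (`½ ≤ β < 1`) is typed on `β < σ < 1`: for `σ ≥ 1` non-vanishing is a theorem (Mathlib's
`DirichletCharacter.LFunction_ne_zero_of_one_le_re`, `χ ≠ 1 ∨ σ ≠ 1`), and at `σ = 1` the principal `L` has a pole (the
Mathlib value there is a junk value), so the typed hypothesis is the printed one. Likewise the conclusion «`L(s, χ) ≠ 0` in
`Re(s) > β`» is typed for non-principal `χ` literally (Thms 8, 9) and for all `χ` (Thm 6) on the strip `β < Re s < 1`.
(3) «has a constant sign for all `x ≥ x₀`» = `(∀ x ≥ x₀, 0 ≤ g x) ∨ (∀ x ≥ x₀, g x ≤ 0)` (weak signs, which is what Landau's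
theorem, §2 Prop 1, uses). (4) «real Dirichlet character» = `∀ a, (χ a).im = 0`; then `χ(p)` is written `(χ p).re`.
Thm 9 is typed for NON-PRINCIPAL real `χ`: it is stated in §4.2 for the `f_χ` of (4.3), introduced in Thm 8 for «a
non-principal Dirichlet character», and for `χ = χ₀` (4.8) is false (the sum is positive) — recorded, not endorsed.
(5) `m_χ` = «the order of the zero of `L(s, χ)` at `s = ½`» = `DirichletDisc.zeroOrder χ (1/2)` (`analyticOrderNatAt`).
(6) The zero-sum conditions (1.25)/(1.29) «`Σ_χ Σ_{ρ_{χ*}} x^{ρ}/ρ = o(√x log x)`» (resp. `o(√x (log x)²)`), with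
«`Σ_{ρ_{χ*}} = lim_{T→∞} Σ_{|Im ρ| ≤ T}`, counted with multiplicity, over the non-trivial zeros of `L(s, χ*)`», are written —
exactly as (1.12) was in `Suzuki2025Chebyshev_thm2_iff` with `zetaZeroSumTrunc` — with the tree's truncated sum
`charZeroSumTrunc χ x T = Σ_{L(ρ,χ)=0, 0<Re ρ<1, |Im ρ| ≤ T} m(ρ) x^ρ/ρ` (`ExplicitFormulaPsiChar.lean`; the zeros of `L(s, χ)`
in the OPEN strip and their multiplicities are those of `L(s, χ*)`, `LFunction_eq_zero_iff_primitiveCharacter`) as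
«for every `ε > 0`, for all large `x`, for all large `T`, `‖Σ_χ charZeroSumTrunc χ x T‖ ≤ ε √x log x`».
(7) Sums «`Σ_{n ≤ y, n ≡ 1 mod q}`» run over `n ∈ Finset.Icc 1 ⌊y⌋₊` with `(n : ZMod q) = 1`; `φ(q) = Nat.totient q`; the
complex-valued Riesz means of Thm 8 and the character-averaged constants `−φ(q)^{-1} Σ_χ (L'/L)(½, χ)` of Thm 6 are typed in
`ℂ` (real left-hand sides are cast), `(L'/L)(½, χ) = logDeriv χ.LFunction (1/2)`.

Deliberately NOT here: the Remark after Thm 8 (Platt/Watkins verifications), and any proof. The `C(q)` display after Thm 6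
(`C(q) := Σ_{χ mod q} (L'/L)(½, χ)`, its closed form `((q−1)/2)(log 8π + C₀) − ((q−2)/2) log q + log q/(√q − 1)` for an odd
prime `q`, and the sign sentence «`C(q) < 0` for odd primes `≤ 47`, `> 0` for primes `≥ 53`») is PROVED / SETTLED in the
tree's `ChebyshevHalfLineBiasSignConstant.lean` (2026-08-27): the closed form is the theorem
`Suzuki2025Chebyshev_charSum_logDeriv_half_eq`, and — AS-PRINTED AUDIT, recorded there — the kernel proves the OPPOSITE signs
from the printed formula (`Suzuki2025Chebyshev_Cq_pos`: `C(q) > 0` for `3 ≤ q ≤ 47`; `Suzuki2025Chebyshev_Cq_neg`: `C(q) < 0`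
for `q ≥ 53`), i.e. the limit `−φ(q)^{-1} Σ_χ (L'/L)(½, χ)` typed in clauses (ii)/(iii) below is negative for the odd primes
`q ≤ 47` and positive for the primes `q ≥ 53` (`Suzuki2025Chebyshev_thm6_constant_re_neg/_pos`; under GRH the sum (1.21) has
that eventual sign, `Suzuki2025Chebyshev_sum121_eventually_neg_of_GRH/_pos_of_GRH`). Every clause below is a criterion
(an implication from a zero-free hypothesis plus a sign condition, or an equivalence with GRH-type hypotheses); nothing in this
file is progress toward RH or GRH.
-/

noncomputable section

open Filter Topology Asymptotics
open scoped Real ArithmeticFunction.vonMangoldt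

namespace Literature.NumberTheory.LFunctions

/-! ## Thm 8: a general non-principal character -/

/-- NAMED FACT — **Thm 8, first half**, AS PRINTED: «Let `χ` be a non-principal Dirichlet character of modulo `q`, and denote
`L(s, χ)` by `L(s)`. Suppose that there exists `x₀ ≥ 2` such that `Σ_{n ≤ x} Λ(n) n^{-1/2} Re(χ(n)) log(x/n)` (4.1) has a
constant sign for all `x ≥ x₀`, and `L(σ) ≠ 0` for `σ > β` for some `1/2 ≤ β < 1`. Then, `L(s) ≠ 0` in the right-half plane
`Re(s) > β`. In particular, if (4.1) has a constant sign for all sufficiently large `x > 0`, and `L(σ) ≠ 0` for `σ > 1/2`,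
then the GRH for `L(s)` holds.» (Printed proof: the Mellin transform (4.4)/(4.4') of `−Σ Λ Re χ …` is
`(s−½)^{-2}[(L'/L)(s, χ) + (L'/L)(s, χ̄)]`; Landau's theorem, §2 Prop 1; residues of `L'/L` are positive and cannot cancel.)
Encodings (2), (3) of the module docstring. Users take `(h : Suzuki2025Chebyshev_thm8_sign)`.
[cite: Suzuki2025Chebyshev, §4.1 Thm 8 (first half)] -/
def Suzuki2025Chebyshev_thm8_sign : Prop :=
  ∀ (q : ℕ) [NeZero q] (χ : DirichletCharacter ℂ q), χ ≠ 1 → ∀ β : ℝ, 1 / 2 ≤ β → β < 1 →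
    (∀ σ : ℝ, β < σ → σ < 1 → χ.LFunction σ ≠ 0) →
    (∃ x₀ : ℝ, 2 ≤ x₀ ∧
      ((∀ x : ℝ, x₀ ≤ x →
          0 ≤ ∑ n ∈ Finset.Icc 1 ⌊x⌋₊, Λ n * (χ (n : ZMod q)).re / Real.sqrt n * Real.log (x / n)) ∨
       (∀ x : ℝ, x₀ ≤ x →
          ∑ n ∈ Finset.Icc 1 ⌊x⌋₊, Λ n * (χ (n : ZMod q)).re / Real.sqrt n * Real.log (x / n) ≤ 0))) →
    (∀ s : ℂ, β < s.re → χ.LFunction s ≠ 0) ∧ (β = 1 / 2 → χ.RiemannHypothesis)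

/-- NAMED FACT — **Thm 8, second half (the Riesz limits)**, AS PRINTED, three clauses: (a) «Suppose that `L(1/2) ≠ 0`.
Then, we have `lim_{x→∞} Σ_{n ≤ x} Λ(n)χ(n) n^{-1/2} (1 − log n/log x) = −(L'/L)(1/2)` (4.2) if and only if the GRH for
`L(s, χ)` holds.» (b) «If `χ` is primitive, then equation (4.2) implies that the sum (4.1) has a constant sign for all
sufficiently large `x > 0`» (printed proof: `Re (L'/L)(½, χ) = ½[log(π/q) − (Γ'/Γ)(¼ + κ/2)] ≠ 0` for every integer `q > 1`,
(4.6)). (c) «Furthermore, suppose that `s = 1/2` is a zero of `L(s)` of order `m ≥ 0`. Then, we have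
`lim_{x→∞} (1/log x) Σ_{n ≤ x} Λ(n)χ(n) n^{-1/2} (1 − log n/log x) = −m/2` (4.2') if and only if the GRH for `L(s, χ)` holds»
(its rider «(4.2') implies that the value of the sum (4.1) is negative for all sufficiently large `x > 0` if `m ≥ 1`» is
recorded here only). `χ` non-principal throughout; complex-valued sums and limits; `m = DirichletDisc.zeroOrder χ (1/2)`
(encoding (5)). Users take `(h : Suzuki2025Chebyshev_thm8_limits)`.
[cite: Suzuki2025Chebyshev, §4.1 Thm 8 (second half: (4.2), the primitive case with (4.6), and the order-m version)] -/
def Suzuki2025Chebyshev_thm8_limits : Prop :=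
  (∀ (q : ℕ) [NeZero q] (χ : DirichletCharacter ℂ q), χ ≠ 1 → χ.LFunction (1 / 2) ≠ 0 →
    (Tendsto (fun x : ℝ ↦ ∑ n ∈ Finset.Icc 1 ⌊x⌋₊,
        (Λ n : ℂ) * χ (n : ZMod q) / (Real.sqrt n : ℂ) * ((1 - Real.log n / Real.log x : ℝ) : ℂ))
      atTop (𝓝 (-logDeriv χ.LFunction (1 / 2))) ↔ χ.RiemannHypothesis)) ∧
  (∀ (q : ℕ) [NeZero q] (χ : DirichletCharacter ℂ q), χ ≠ 1 → χ.IsPrimitive → χ.LFunction (1 / 2) ≠ 0 →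
    Tendsto (fun x : ℝ ↦ ∑ n ∈ Finset.Icc 1 ⌊x⌋₊,
        (Λ n : ℂ) * χ (n : ZMod q) / (Real.sqrt n : ℂ) * ((1 - Real.log n / Real.log x : ℝ) : ℂ))
      atTop (𝓝 (-logDeriv χ.LFunction (1 / 2))) →
    ∃ x₀ : ℝ,
      (∀ x : ℝ, x₀ ≤ x →
          0 ≤ ∑ n ∈ Finset.Icc 1 ⌊x⌋₊, Λ n * (χ (n : ZMod q)).re / Real.sqrt n * Real.log (x / n)) ∨
      (∀ x : ℝ, x₀ ≤ x →
          ∑ n ∈ Finset.Icc 1 ⌊x⌋₊, Λ n * (χ (n : ZMod q)).re / Real.sqrt n * Real.log (x / n) ≤ 0)) ∧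
  (∀ (q : ℕ) [NeZero q] (χ : DirichletCharacter ℂ q), χ ≠ 1 →
    (Tendsto (fun x : ℝ ↦ (1 / (Real.log x : ℂ)) * ∑ n ∈ Finset.Icc 1 ⌊x⌋₊,
        (Λ n : ℂ) * χ (n : ZMod q) / (Real.sqrt n : ℂ) * ((1 - Real.log n / Real.log x : ℝ) : ℂ))
      atTop (𝓝 (-((DirichletDisc.zeroOrder χ (1 / 2) : ℂ) / 2))) ↔ χ.RiemannHypothesis))

/-! ## Thm 9: a real character, the prime sum with weight `√(x/p) log(x/p)` -/

/-- NAMED FACT — **Thm 9, first half**, AS PRINTED: «Let `χ` be a real Dirichlet character such that `L(σ, χ) ≠ 0` for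
`σ > β (≥ 1/2)`. Suppose that `Σ_{p ≤ x} χ(p) log p · √(x/p) log(x/p) ≤ 0` (4.7) for all sufficiently large `x > 1`. Then,
`L(s, χ) ≠ 0` in the right-half plane `Re(s) > β`. In particular, if `β = 1/2`, the GRH for `L(s, χ)` holds.» Typed for
non-principal real `χ` (encoding (4): in §4.2 `χ` is the non-principal character of Thm 8's `f_χ`; Thm 4 = the case
`χ = χ₄`), with `½ ≤ β < 1` and the zero-free hypothesis on `(β, 1)` (encoding (2)). Printed proof: `f_χ = f₁ + f₂ + f₃`,
the transforms of `f₂`, `f₃` analytic on `Re s > ½` ((4.9)–(4.11)), Landau's theorem. Users take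
`(h : Suzuki2025Chebyshev_thm9_sign)`. [cite: Suzuki2025Chebyshev, §4.2 Thm 9 (first half)] -/
def Suzuki2025Chebyshev_thm9_sign : Prop :=
  ∀ (q : ℕ) [NeZero q] (χ : DirichletCharacter ℂ q), χ ≠ 1 → (∀ a : ZMod q, (χ a).im = 0) →
    ∀ β : ℝ, 1 / 2 ≤ β → β < 1 → (∀ σ : ℝ, β < σ → σ < 1 → χ.LFunction σ ≠ 0) →
    (∃ x₀ : ℝ, ∀ x : ℝ, x₀ ≤ x →
      ∑ p ∈ (Finset.Icc 1 ⌊x⌋₊).filter Nat.Prime,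
        (χ (p : ZMod q)).re * Real.log p * Real.sqrt (x / p) * Real.log (x / p) ≤ 0) →
    (∀ s : ℂ, β < s.re → χ.LFunction s ≠ 0) ∧ (β = 1 / 2 → χ.RiemannHypothesis)

/-- NAMED FACT — **Thm 9, second half (the asymptotic (4.8))**, AS PRINTED: «Conversely, suppose that the GRH for `L(s, χ)`
holds and `L(1/2, χ) ≠ 0`. Then, the asymptotic formula `Σ_{p ≤ x} χ(p) log p · √(x/p) log(x/p) = −(√x/4)(log x)²
(1 + O(1/log x))` (4.8) holds as `x → ∞`. Therefore, (4.7) is valid for all sufficiently large `x > 1`, and the left-hand side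
of (4.7) tends to `−∞` as `x → ∞`.» For non-principal real `χ` (encoding (4)); (4.8) as
`Σ_{p ≤ x} … + (√x/4)(log x)² = O(√x log x)`. Printed proof: GRH gives `f_χ = O(log x)` ((4.5)), while
`f₂ = ¼(log x)² + O(log x)` (Mertens, (2.1)) and `f₃ = O(log x)`. Users take `(h : Suzuki2025Chebyshev_thm9_asymp)`.
[cite: Suzuki2025Chebyshev, §4.2 Thm 9 (second half, (4.8))] -/
def Suzuki2025Chebyshev_thm9_asymp : Prop :=
  ∀ (q : ℕ) [NeZero q] (χ : DirichletCharacter ℂ q), χ ≠ 1 → (∀ a : ZMod q, (χ a).im = 0) →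
    χ.RiemannHypothesis → χ.LFunction (1 / 2) ≠ 0 →
    (fun x : ℝ ↦ ∑ p ∈ (Finset.Icc 1 ⌊x⌋₊).filter Nat.Prime,
        (χ (p : ZMod q)).re * Real.log p * Real.sqrt (x / p) * Real.log (x / p)
      + Real.sqrt x / 4 * Real.log x ^ 2) =O[atTop] fun x : ℝ ↦ Real.sqrt x * Real.log x

/-! ## Thm 6: all characters modulo `q`, the progression `n ≡ 1 (mod q)` -/

/-- NAMED FACT — **Thm 6 (i)**, AS PRINTED: «Let `q` be a positive integer, and let `β = β(q)` be a real number such that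
`1/2 ≤ β < 1` and `L(σ, χ) ≠ 0` for all `σ > β` and all Dirichlet character `χ` modulo `q`. (i) Suppose that there exists
`x₀ ≥ 2` such that either `Σ_{n ≤ x, n ≡ 1 mod q} Λ(n) n^{-1/2} log(x/n) − 4√x/φ(q)` (1.21) has a constant sign for all
`x ≥ x₀`, or `Σ_{n ≤ xe², n ≡ 1 mod q} Λ(n) n^{-1/2} log(x/n)` (1.22) has a constant sign for all `x ≥ x₀`. Then `L(s, χ) ≠ 0`
in the right half-plane `Re(s) > β` for all `χ` modulo `q`. In particular, if `β = 1/2`, the GRH for `L(s, χ)` holds for all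
Dirichlet characters `χ` modulo `q`.» Encodings (2), (3), (7): zero-free hypothesis on `(β, 1)` (at `σ = 1` the principal
`L` has a pole), conclusion on the strip `β < Re s < 1` (for `Re s ≥ 1` non-vanishing is Mathlib's theorem). Printed proof
(§5.1): orthogonality (5.1), the transforms (5.4)/(5.6) = `φ(q)^{-1} Σ_χ (L'/L)(s, χ)` times `(s−½)^{-2}` resp.
`2(1−s)(s−½)^{-2}` (the pole of `(L'/L)(s, χ₀)` at `s = 1` cancelled), Landau. Users take `(h : Suzuki2025Chebyshev_thm6_i)`.
[cite: Suzuki2025Chebyshev, §1.3 Thm 6 (i); proof §5.1 (5.1)–(5.6)] -/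
def Suzuki2025Chebyshev_thm6_i : Prop :=
  ∀ (q : ℕ) [NeZero q] (β : ℝ), 1 / 2 ≤ β → β < 1 →
    (∀ χ : DirichletCharacter ℂ q, ∀ σ : ℝ, β < σ → σ < 1 → χ.LFunction σ ≠ 0) →
    (∃ x₀ : ℝ, 2 ≤ x₀ ∧
      (((∀ x : ℝ, x₀ ≤ x → 0 ≤ ∑ n ∈ (Finset.Icc 1 ⌊x⌋₊).filter (fun n : ℕ ↦ (n : ZMod q) = 1),
            Λ n / Real.sqrt n * Real.log (x / n) - 4 * Real.sqrt x / Nat.totient q) ∨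
        (∀ x : ℝ, x₀ ≤ x → ∑ n ∈ (Finset.Icc 1 ⌊x⌋₊).filter (fun n : ℕ ↦ (n : ZMod q) = 1),
            Λ n / Real.sqrt n * Real.log (x / n) - 4 * Real.sqrt x / Nat.totient q ≤ 0)) ∨
       ((∀ x : ℝ, x₀ ≤ x → 0 ≤ ∑ n ∈ (Finset.Icc 1 ⌊x * Real.exp 2⌋₊).filter (fun n : ℕ ↦ (n : ZMod q) = 1),
            Λ n / Real.sqrt n * Real.log (x / n)) ∨
        (∀ x : ℝ, x₀ ≤ x → ∑ n ∈ (Finset.Icc 1 ⌊x * Real.exp 2⌋₊).filter (fun n : ℕ ↦ (n : ZMod q) = 1),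
            Λ n / Real.sqrt n * Real.log (x / n) ≤ 0)))) →
    (∀ χ : DirichletCharacter ℂ q, ∀ s : ℂ, β < s.re → s.re < 1 → χ.LFunction s ≠ 0) ∧
      (β = 1 / 2 → ∀ χ : DirichletCharacter ℂ q, χ.RiemannHypothesis)

/-- NAMED FACT — **Thm 6 (ii)–(v) (the Riesz limits)**, AS PRINTED: «(ii) Suppose that `L(1/2, χ) ≠ 0` for all
Dirichlet character `χ` modulo `q`. Then, we have `lim_{x→∞} (Σ_{n ≤ x, n ≡ 1 mod q} Λ(n) n^{-1/2}(1 − log n/log x)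
− 4√x/(φ(q) log x)) = −φ(q)^{-1} Σ_{χ mod q} (L'/L)(1/2, χ)` (1.23) if and only if the GRH for `L(s, χ)` holds for all
Dirichlet characters `χ` modulo `q`. (iii) Suppose that `L(1/2, χ) ≠ 0` for all Dirichlet character `χ` modulo `q`. Then, we
have `lim_{x→∞} Σ_{n ≤ xe², n ≡ 1 mod q} Λ(n) n^{-1/2}(1 − log n/log x) = −φ(q)^{-1} Σ_{χ mod q} (L'/L)(1/2, χ)` (1.24) if and
only if the GRH for `L(s, χ)` holds for all Dirichlet characters `χ` modulo `q` and
`Σ_{χ mod q} Σ_{ρ_{χ*}} x^{ρ_{χ*}}/ρ_{χ*} = o(√x log x)` (1.25) holds as `x → ∞` for nontrivial zeros of `L(s, χ*)` for all `χ`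
modulo `q`, where `χ*` is a primitive Dirichlet character that induces `χ`. (iv) Let `m_χ` denote the order of the zero of
`L(s, χ)` at `s = 1/2`. Then, we have `lim_{x→∞} ((1/log x) Σ_{n ≤ x, n ≡ 1 mod q} Λ(n) n^{-1/2}(1 − log n/log x)
− 4√x/(φ(q)(log x)²)) = −½ Σ_{χ mod q} m_χ` (1.28) if and only if the GRH for `L(s, χ)` holds for all Dirichlet characters
`χ` modulo `q`. (v) Under the notation of the third and fourth statements, we have
`lim_{x→∞} (1/log x) Σ_{n ≤ xe², n ≡ 1 mod q} Λ(n) n^{-1/2}(1 − log n/log x) = −½ Σ_{χ mod q} m_χ` (1.29) if and only if the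
GRH for `L(s, χ)` holds for all Dirichlet characters `χ` modulo `q` and `Σ_{χ mod q} Σ_{ρ_{χ*}} x^{ρ_{χ*}}/ρ_{χ*} = o(√x (log x)²)`
(1.30) holds as `x → ∞`.» The four clauses in this order; encodings (5), (6), (7) of the module docstring (real left-hand
sides of (ii), (iii) cast to `ℂ`; `m_χ = DirichletDisc.zeroOrder χ (1/2)`; zero sums via `charZeroSumTrunc`). Printed proof:
§5.1, (5.7)–(5.9). Users take `(h : Suzuki2025Chebyshev_thm6_limits)`.
AS-PRINTED AUDIT (2026-08-27, recorded, not repaired here): in (1.28) and (1.29) the printed limit `−½ Σ_χ m_χ` lacks the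
factor `φ(q)^{-1}` that (1.23) and the §5.1 derivation (orthogonality (5.1), `φ(q)F_q(x) = …`) carry — the tree's kernel
theorem `SuzukiThm6iv.Suzuki2025Chebyshev_thm6_iv_as_printed_iff` (`ChebyshevHalfLineBiasThm6ivProofs.lean`) shows that clause
(iv) AS TYPED below holds iff (GRH for all `χ` mod `q`) ∧ (`φ(q) = 1` ∨ `Σ_χ m_χ = 0`), while the equivalence with the limit
`−(2φ(q))^{-1} Σ_χ m_χ` is the tree's `Suzuki2025Chebyshev_thm6_iv_corrected`; clauses (iv)/(v) are kept verbatim as printed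
(a discharge of this fact as typed would need `Σ_χ m_χ = 0`); clause (ii) is the tree's `Suzuki2025Chebyshev_thm6_ii`.
[cite: Suzuki2025Chebyshev, §1.3 Thm 6 (ii)–(v), eqs. (1.23)–(1.25), (1.28)–(1.30); proof §5.1] -/
def Suzuki2025Chebyshev_thm6_limits : Prop :=
  (∀ (q : ℕ) [NeZero q], (∀ χ : DirichletCharacter ℂ q, χ.LFunction (1 / 2) ≠ 0) →
    (Tendsto (fun x : ℝ ↦ (((∑ n ∈ (Finset.Icc 1 ⌊x⌋₊).filter (fun n : ℕ ↦ (n : ZMod q) = 1),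
          Λ n / Real.sqrt n * (1 - Real.log n / Real.log x))
        - 4 * Real.sqrt x / (Nat.totient q * Real.log x) : ℝ) : ℂ)) atTop
      (𝓝 (-(1 / (Nat.totient q : ℂ)) * ∑ χ : DirichletCharacter ℂ q, logDeriv χ.LFunction (1 / 2))) ↔
      ∀ χ : DirichletCharacter ℂ q, χ.RiemannHypothesis)) ∧
  (∀ (q : ℕ) [NeZero q], (∀ χ : DirichletCharacter ℂ q, χ.LFunction (1 / 2) ≠ 0) →
    (Tendsto (fun x : ℝ ↦ ((∑ n ∈ (Finset.Icc 1 ⌊x * Real.exp 2⌋₊).filter (fun n : ℕ ↦ (n : ZMod q) = 1),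
          Λ n / Real.sqrt n * (1 - Real.log n / Real.log x) : ℝ) : ℂ)) atTop
      (𝓝 (-(1 / (Nat.totient q : ℂ)) * ∑ χ : DirichletCharacter ℂ q, logDeriv χ.LFunction (1 / 2))) ↔
      (∀ χ : DirichletCharacter ℂ q, χ.RiemannHypothesis) ∧
        ∀ ε : ℝ, 0 < ε → ∀ᶠ x : ℝ in atTop, ∀ᶠ T : ℝ in atTop,
          ‖∑ χ : DirichletCharacter ℂ q, charZeroSumTrunc χ x T‖ ≤ ε * (Real.sqrt x * Real.log x))) ∧
  (∀ (q : ℕ) [NeZero q],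
    (Tendsto (fun x : ℝ ↦ (1 / Real.log x) * ∑ n ∈ (Finset.Icc 1 ⌊x⌋₊).filter (fun n : ℕ ↦ (n : ZMod q) = 1),
          Λ n / Real.sqrt n * (1 - Real.log n / Real.log x)
        - 4 * Real.sqrt x / (Nat.totient q * Real.log x ^ 2)) atTop
      (𝓝 (-(1 / 2 : ℝ) * ∑ χ : DirichletCharacter ℂ q, (DirichletDisc.zeroOrder χ (1 / 2) : ℝ))) ↔
      ∀ χ : DirichletCharacter ℂ q, χ.RiemannHypothesis)) ∧
  (∀ (q : ℕ) [NeZero q],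
    (Tendsto (fun x : ℝ ↦ (1 / Real.log x) * ∑ n ∈ (Finset.Icc 1 ⌊x * Real.exp 2⌋₊).filter (fun n : ℕ ↦ (n : ZMod q) = 1),
          Λ n / Real.sqrt n * (1 - Real.log n / Real.log x)) atTop
      (𝓝 (-(1 / 2 : ℝ) * ∑ χ : DirichletCharacter ℂ q, (DirichletDisc.zeroOrder χ (1 / 2) : ℝ))) ↔
      (∀ χ : DirichletCharacter ℂ q, χ.RiemannHypothesis) ∧
        ∀ ε : ℝ, 0 < ε → ∀ᶠ x : ℝ in atTop, ∀ᶠ T : ℝ in atTop,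
          ‖∑ χ : DirichletCharacter ℂ q, charZeroSumTrunc χ x T‖ ≤ ε * (Real.sqrt x * Real.log x ^ 2)))

end Literature.NumberTheory.LFunctions

end
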